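import Mathlib.NumberTheory.Padics.Hensel
import Mathlib.Algebra.Polynomial.Roots
import Mathlib.Data.Set.Card
import Mathlib.Topology.Algebra.Ring.Basic

/-!
# The number of `ℤ_p`-roots of `x³ + ax + b` is locally constant in `(a, b)` off the discriminant

Topic `Literature/Algebra/Polynomial`; Mathlib-only, everything proved.

**Theorem** (`ncard_roots_eq_of_congr`, `eventually_ncard_roots_eq`). Let `a, b ∈ ℤ_p` with
`D = 4a³ + 27b² ≠ 0` and let `k` be so large that `p⁻ᵏ < |D|_p`. If `a' ≡ a`, `b' ≡ b (mod pᵏ)`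
then `x³ + a'x + b'` and `x³ + ax + b` have the same number of roots in `ℤ_p`. Consequently the
number of roots is a locally constant function of `(a, b)` on `{4a³ + 27b² ≠ 0} ⊆ ℤ_p²`.

Proof. For a root `s` of `F = x³ + ax + b` one has the factorisation `F = (x − s)·G`,
`G = x² + sx + (s² + a)`, with `G(s) = F'(s) = 3s² + a` and
**`4a³ + 27b² = (3s² + 4a)·(3s² + a)²`** (`four_a_cube_add_eq`; `−(3s² + 4a) = disc G`), whence
`|D|_p ≤ |F'(s)|_p²`. So `|F_{a',b'}(s)| ≤ p⁻ᵏ < |F'(s)|² = |F'_{a',b'}(s)|²` and Hensel's lemma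
(Mathlib `hensels_lemma`) produces a root `z` of `F_{a',b'}` with `|z − s| < |F'(s)|`. Two distinct
roots `s₁ ≠ s₂` of `F` satisfy `|s₁ − s₂| ≥ |F'(sᵢ)|` (`F'(s₁) = (s₁ − s₂)(2s₁ + s₂)`), so
`s ↦ z` is injective; by symmetry the two root sets have the same size.

This is the regularity in `(I, J)` of `#E_{I,J}(ℚ_p)[2] = 1 + #{φ ∈ ℚ_p : φ³ − 3Iφ + J = 0}`
(Bhargava–Shankar, Ann. of Math. 181 (2015), Lemma 5.11 of arXiv:1006.1002v2 / Thm 3.2 of the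
published version; tree: `BinaryQuartic.pgl2StabilizerCard_eq`), used when the `p`-adic masses of
their Prop. 3.9 are handled fibre by fibre; the companion statement for binary quartic forms is in
`Literature/NumberTheory/EllipticCurves`.

## References

* Hensel's lemma for `ℤ_p` (Mathlib `hensels_lemma`, after K. Conrad's notes). [folklore]
* M. Bhargava, A. Shankar, Ann. of Math. (2) 181 (2015) 191–242, Lemma 5.11 / Thm 3.2 (use).
-/

noncomputable section

open scoped Classical Topology
open Polynomial Filter

namespace Literature.Algebra.Polynomial

variable {p : ℕ} [Fact p.Prime]

/-! ## Algebra of the depressed cubic -/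

/-- **The key identity**: if `s³ + as + b = 0` then `4a³ + 27b² = (3s² + 4a)(3s² + a)²`
(`= −disc(x² + sx + s² + a) · F'(s)²`). [folklore] -/
theorem four_a_cube_add_eq {R : Type*} [CommRing R] {a b s : R} (hs : s ^ 3 + a * s + b = 0) :
    4 * a ^ 3 + 27 * b ^ 2 = (3 * s ^ 2 + 4 * a) * (3 * s ^ 2 + a) ^ 2 := by
  have hb : b = -(s ^ 3 + a * s) := by linear_combination hs
  rw [hb]; ring

/-- Two roots: if `s₁ ≠ s₂` are roots of `x³ + ax + b` over a domain then
`3s₁² + a = (s₁ − s₂)(2s₁ + s₂)`. [folklore] -/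
theorem deriv_eq_mul_of_two_roots {R : Type*} [CommRing R] [IsDomain R] {a b s₁ s₂ : R}
    (h₁ : s₁ ^ 3 + a * s₁ + b = 0) (h₂ : s₂ ^ 3 + a * s₂ + b = 0) (hne : s₁ ≠ s₂) :
    3 * s₁ ^ 2 + a = (s₁ - s₂) * (2 * s₁ + s₂) := by
  -- `(s₁ − s₂)(s₁² + s₁s₂ + s₂² + a) = 0`, so `a = −(s₁² + s₁s₂ + s₂²)`
  have hprod : (s₁ - s₂) * (s₁ ^ 2 + s₁ * s₂ + s₂ ^ 2 + a) = 0 := by linear_combination h₁ - h₂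
  have ha : s₁ ^ 2 + s₁ * s₂ + s₂ ^ 2 + a = 0 :=
    (mul_eq_zero.mp hprod).resolve_left (sub_ne_zero.mpr hne)
  linear_combination ha

/-- The root set of `x³ + ax + b` over a domain is finite (at most three elements). [folklore] -/
theorem finite_setOf_cubic_eq_zero {R : Type*} [CommRing R] [IsDomain R] (a b : R) :
    {s : R | s ^ 3 + a * s + b = 0}.Finite := by
  have hP : (X ^ 3 + C a * X + C b : R[X]) ≠ 0 := by
    intro h0
    have := congrArg (fun P : R[X] ↦ P.coeff 3) h0
    simp at this
  refine ((X ^ 3 + C a * X + C b : R[X]).roots.toFinset.finite_toSet).subset fun s hs ↦ ?_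
  simp only [Set.mem_setOf_eq] at hs
  simp only [Finset.mem_coe, Multiset.mem_toFinset, mem_roots hP, IsRoot.def, eval_add, eval_pow, eval_X,
    eval_mul, eval_C]
  exact hs

/-! ## Norm estimates over `ℤ_p` -/

/-- `|4a³ + 27b²|_p ≤ |3s² + a|_p²` at a root `s`. [folklore] -/
theorem norm_disc_le_norm_deriv_sq {a b s : ℤ_[p]} (hs : s ^ 3 + a * s + b = 0) :
    ‖4 * a ^ 3 + 27 * b ^ 2‖ ≤ ‖3 * s ^ 2 + a‖ ^ 2 := by
  rw [four_a_cube_add_eq hs, norm_mul, norm_pow]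
  exact mul_le_of_le_one_left (sq_nonneg _) (PadicInt.norm_le_one _)

/-- Congruent parameters have discriminants of the same norm, once `p⁻ᵏ < |4a³ + 27b²|_p`. [folklore] -/
theorem norm_disc_eq_of_congr {k : ℕ} {a b a' b' : ℤ_[p]} (ha : (p : ℤ_[p]) ^ k ∣ a' - a)
    (hb : (p : ℤ_[p]) ^ k ∣ b' - b) (hk : (p : ℝ) ^ (-(k : ℤ)) < ‖4 * a ^ 3 + 27 * b ^ 2‖) :
    ‖4 * a' ^ 3 + 27 * b' ^ 2‖ = ‖4 * a ^ 3 + 27 * b ^ 2‖ := by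
  obtain ⟨u, hu⟩ := ha
  obtain ⟨v, hv⟩ := hb
  have ha' : a' = a + (p : ℤ_[p]) ^ k * u := by linear_combination hu
  have hb' : b' = b + (p : ℤ_[p]) ^ k * v := by linear_combination hv
  set w : ℤ_[p] := 4 * (3 * a ^ 2 * u + 3 * a * (p : ℤ_[p]) ^ k * u ^ 2 + ((p : ℤ_[p]) ^ k) ^ 2 * u ^ 3)
    + 27 * (2 * b * v + (p : ℤ_[p]) ^ k * v ^ 2) with hw
  have hdiff : 4 * a' ^ 3 + 27 * b' ^ 2 = (4 * a ^ 3 + 27 * b ^ 2) + (p : ℤ_[p]) ^ k * w := by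
    rw [ha', hb', hw]; ring
  have hsmall : ‖(p : ℤ_[p]) ^ k * w‖ < ‖4 * a ^ 3 + 27 * b ^ 2‖ := by
    rw [norm_mul, PadicInt.norm_p_pow]
    exact lt_of_le_of_lt (mul_le_of_le_one_right (zpow_nonneg (Nat.cast_nonneg _) _) (PadicInt.norm_le_one w)) hk
  rw [hdiff, add_comm, PadicInt.norm_add_eq_max_of_ne hsmall.ne, max_eq_right hsmall.le]

/-- **Root transfer (Hensel).** If `s` is a root of `x³ + ax + b`, `4a³ + 27b² ≠ 0`, `p⁻ᵏ <
|4a³ + 27b²|_p` and `(a', b') ≡ (a, b) (mod pᵏ)`, then `x³ + a'x + b'` has a unique root `z` with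
`|z − s|_p < |3s² + a|_p`. [folklore] -/
theorem exists_root_near_of_congr {k : ℕ} {a b a' b' s : ℤ_[p]} (hs : s ^ 3 + a * s + b = 0)
    (ha : (p : ℤ_[p]) ^ k ∣ a' - a) (hb : (p : ℤ_[p]) ^ k ∣ b' - b)
    (hk : (p : ℝ) ^ (-(k : ℤ)) < ‖4 * a ^ 3 + 27 * b ^ 2‖) :
    ∃ z : ℤ_[p], z ^ 3 + a' * z + b' = 0 ∧ ‖z - s‖ < ‖3 * s ^ 2 + a‖ ∧
      ∀ z' : ℤ_[p], z' ^ 3 + a' * z' + b' = 0 → ‖z' - s‖ < ‖3 * s ^ 2 + a‖ → z' = z := by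
  set F : ℤ_[p][X] := X ^ 3 + C a' * X + C b' with hF
  have hFeval : ∀ x : ℤ_[p], F.aeval x = x ^ 3 + a' * x + b' := fun x ↦ by
    simp [hF, aeval_def, eval₂_add, eval₂_pow, eval₂_X, eval₂_mul, eval₂_C]
  have hF'eval : ∀ x : ℤ_[p], F.derivative.aeval x = 3 * x ^ 2 + a' := fun x ↦ by
    simp [hF, aeval_def, derivative_add, derivative_pow, derivative_X, derivative_mul, derivative_C,
      eval₂_add, eval₂_mul, eval₂_pow, eval₂_X, eval₂_C]
  -- sizes
  have hpk : 0 < (p : ℝ) ^ (-(k : ℤ)) := zpow_pos (by exact_mod_cast (Fact.out : p.Prime).pos) _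
  have hD_le : ‖4 * a ^ 3 + 27 * b ^ 2‖ ≤ ‖3 * s ^ 2 + a‖ ^ 2 := norm_disc_le_norm_deriv_sq hs
  have hsq_le : ‖3 * s ^ 2 + a‖ ^ 2 ≤ ‖3 * s ^ 2 + a‖ := by
    rw [sq]; exact mul_le_of_le_one_left (norm_nonneg _) (PadicInt.norm_le_one _)
  obtain ⟨u, hu⟩ := ha
  obtain ⟨v, hv⟩ := hb
  -- `F(s)` is small
  have hFs : ‖F.aeval s‖ ≤ (p : ℝ) ^ (-(k : ℤ)) := by
    rw [hFeval]
    have : s ^ 3 + a' * s + b' = (p : ℤ_[p]) ^ k * (u * s + v) := by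
      have h1 : a' = a + (p : ℤ_[p]) ^ k * u := by linear_combination hu
      have h2 : b' = b + (p : ℤ_[p]) ^ k * v := by linear_combination hv
      rw [h1, h2]; linear_combination hs
    rw [this, norm_mul, PadicInt.norm_p_pow]
    exact mul_le_of_le_one_right (zpow_nonneg (Nat.cast_nonneg _) _) (PadicInt.norm_le_one _)
  -- `F'(s)` has the norm of `3s² + a`
  have hF's : ‖F.derivative.aeval s‖ = ‖3 * s ^ 2 + a‖ := by
    rw [hF'eval]
    have h1 : 3 * s ^ 2 + a' = (3 * s ^ 2 + a) + (p : ℤ_[p]) ^ k * u := by linear_combination hu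
    have hsmall : ‖(p : ℤ_[p]) ^ k * u‖ < ‖3 * s ^ 2 + a‖ := by
      rw [norm_mul, PadicInt.norm_p_pow]
      refine lt_of_le_of_lt (mul_le_of_le_one_right (zpow_nonneg (Nat.cast_nonneg _) _) (PadicInt.norm_le_one u)) ?_
      exact hk.trans_le (hD_le.trans hsq_le)
    rw [h1, add_comm, PadicInt.norm_add_eq_max_of_ne hsmall.ne, max_eq_right hsmall.le]
  have hnorm : ‖F.aeval s‖ < ‖F.derivative.aeval s‖ ^ 2 := by
    rw [hF's]
    exact lt_of_le_of_lt hFs (hk.trans_le hD_le)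
  obtain ⟨z, hz, hzs, -, huniq⟩ := hensels_lemma hnorm
  refine ⟨z, by rw [← hFeval]; exact hz, by rw [← hF's]; exact hzs, fun z' hz' hz's ↦ huniq z' ?_ ?_⟩
  · rw [hFeval]; exact hz'
  · rw [hF's]; exact hz's

/-- **Separation of roots**: distinct roots `s₁ ≠ s₂` of `x³ + ax + b` satisfy
`|3s₁² + a|_p ≤ |s₁ − s₂|_p`. [folklore] -/
theorem norm_deriv_le_norm_sub {a b s₁ s₂ : ℤ_[p]} (h₁ : s₁ ^ 3 + a * s₁ + b = 0)
    (h₂ : s₂ ^ 3 + a * s₂ + b = 0) (hne : s₁ ≠ s₂) : ‖3 * s₁ ^ 2 + a‖ ≤ ‖s₁ - s₂‖ := by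
  rw [deriv_eq_mul_of_two_roots h₁ h₂ hne, norm_mul]
  exact mul_le_of_le_one_right (norm_nonneg _) (PadicInt.norm_le_one _)

/-! ## The count -/

/-- One direction of the count: under the hypotheses of `exists_root_near_of_congr`, root transfer
is injective, so `#{roots of x³ + ax + b} ≤ #{roots of x³ + a'x + b'}`. [folklore] -/
theorem ncard_roots_le_of_congr {k : ℕ} {a b a' b' : ℤ_[p]}
    (ha : (p : ℤ_[p]) ^ k ∣ a' - a) (hb : (p : ℤ_[p]) ^ k ∣ b' - b)
    (hk : (p : ℝ) ^ (-(k : ℤ)) < ‖4 * a ^ 3 + 27 * b ^ 2‖) :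
    {s : ℤ_[p] | s ^ 3 + a * s + b = 0}.ncard ≤ {s : ℤ_[p] | s ^ 3 + a' * s + b' = 0}.ncard := by
  -- the transfer map
  have key : ∀ s : {s : ℤ_[p] | s ^ 3 + a * s + b = 0}, ∃ z : ℤ_[p], z ^ 3 + a' * z + b' = 0 ∧
      ‖z - s‖ < ‖3 * (s : ℤ_[p]) ^ 2 + a‖ := fun s ↦ by
    obtain ⟨z, hz, hzs, -⟩ := exists_root_near_of_congr s.2 ha hb hk
    exact ⟨z, hz, hzs⟩
  choose Φ hΦ hΦs using key
  have hinj : Function.Injective Φ := by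
    intro s₁ s₂ h
    by_contra hne
    have hne' : (s₁ : ℤ_[p]) ≠ s₂ := fun h' ↦ hne (Subtype.ext h')
    have h1 := hΦs s₁
    have h2 := hΦs s₂
    rw [h] at h1
    -- `|s₁ − s₂| ≤ max(|Φ − s₁|, |Φ − s₂|) < max(|F'(s₁)|, |F'(s₂)|) ≤ |s₁ − s₂|`
    have hsub : (s₁ : ℤ_[p]) - s₂ = (Φ s₂ - s₂) - (Φ s₂ - s₁) := by ring
    have hle : ‖(s₁ : ℤ_[p]) - s₂‖ ≤ max ‖Φ s₂ - s₂‖ ‖Φ s₂ - s₁‖ := by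
      rw [hsub, sub_eq_add_neg]
      refine (PadicInt.nonarchimedean _ _).trans ?_
      rw [norm_neg]
    have hlt : max ‖Φ s₂ - s₂‖ ‖Φ s₂ - s₁‖ < ‖(s₁ : ℤ_[p]) - s₂‖ := by
      refine max_lt ?_ ?_
      · exact h2.trans_le (by rw [norm_sub_rev]; exact norm_deriv_le_norm_sub s₂.2 s₁.2 hne'.symm)
      · exact h1.trans_le (norm_deriv_le_norm_sub s₁.2 s₂.2 hne')
    exact absurd (hle.trans_lt hlt) (lt_irrefl _)
  have hfin' := finite_setOf_cubic_eq_zero a' b'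
  haveI := hfin'.to_subtype
  haveI := (finite_setOf_cubic_eq_zero a b).to_subtype
  rw [← Nat.card_coe_set_eq, ← Nat.card_coe_set_eq]
  exact Nat.card_le_card_of_injective (fun s ↦ (⟨Φ s, hΦ s⟩ : {s : ℤ_[p] | s ^ 3 + a' * s + b' = 0}))
    fun s₁ s₂ h ↦ hinj (congrArg Subtype.val h)

/-- **The number of `ℤ_p`-roots of `x³ + ax + b` is unchanged under `(a, b) ↦ (a', b') ≡ (a, b)
(mod pᵏ)` when `p⁻ᵏ < |4a³ + 27b²|_p`.** [folklore] -/
theorem ncard_roots_eq_of_congr {k : ℕ} {a b a' b' : ℤ_[p]}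
    (ha : (p : ℤ_[p]) ^ k ∣ a' - a) (hb : (p : ℤ_[p]) ^ k ∣ b' - b)
    (hk : (p : ℝ) ^ (-(k : ℤ)) < ‖4 * a ^ 3 + 27 * b ^ 2‖) :
    {s : ℤ_[p] | s ^ 3 + a' * s + b' = 0}.ncard = {s : ℤ_[p] | s ^ 3 + a * s + b = 0}.ncard := by
  refine le_antisymm ?_ (ncard_roots_le_of_congr ha hb hk)
  have ha' : (p : ℤ_[p]) ^ k ∣ a - a' := by rw [← neg_sub]; exact (dvd_neg).mpr ha
  have hb' : (p : ℤ_[p]) ^ k ∣ b - b' := by rw [← neg_sub]; exact (dvd_neg).mpr hb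
  have hk' : (p : ℝ) ^ (-(k : ℤ)) < ‖4 * a' ^ 3 + 27 * b' ^ 2‖ := by
    rwa [norm_disc_eq_of_congr ha hb hk]
  exact ncard_roots_le_of_congr ha' hb' hk'

/-- **Congruence form with an explicit modulus**: for `4a³ + 27b² ≠ 0` there is `k` such that all
`(a', b') ≡ (a, b) (mod pᵏ)` give the same number of roots. [folklore] -/
theorem exists_pow_forall_ncard_roots_eq {a b : ℤ_[p]} (hD : 4 * a ^ 3 + 27 * b ^ 2 ≠ 0) :
    ∃ k : ℕ, ∀ a' b' : ℤ_[p], (p : ℤ_[p]) ^ k ∣ a' - a → (p : ℤ_[p]) ^ k ∣ b' - b →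
      {s : ℤ_[p] | s ^ 3 + a' * s + b' = 0}.ncard = {s : ℤ_[p] | s ^ 3 + a * s + b = 0}.ncard := by
  obtain ⟨k, hk⟩ := PadicInt.exists_pow_neg_lt p (norm_pos_iff.mpr hD)
  exact ⟨k, fun a' b' ha hb ↦ ncard_roots_eq_of_congr ha hb hk⟩

/-- **Topological form**: the number of `ℤ_p`-roots of `x³ + ax + b` is locally constant in
`(a, b)` on `{4a³ + 27b² ≠ 0}`. [folklore] -/
theorem eventually_ncard_roots_eq {a b : ℤ_[p]} (hD : 4 * a ^ 3 + 27 * b ^ 2 ≠ 0) :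
    ∀ᶠ ab : ℤ_[p] × ℤ_[p] in 𝓝 (a, b),
      {s : ℤ_[p] | s ^ 3 + ab.1 * s + ab.2 = 0}.ncard = {s : ℤ_[p] | s ^ 3 + a * s + b = 0}.ncard := by
  obtain ⟨k, hk⟩ := exists_pow_forall_ncard_roots_eq hD
  have hpos : (0 : ℝ) < (p : ℝ) ^ (-(k : ℤ)) := zpow_pos (by exact_mod_cast (Fact.out : p.Prime).pos) _
  have h1 : ∀ᶠ ab : ℤ_[p] × ℤ_[p] in 𝓝 (a, b), dist ab (a, b) < (p : ℝ) ^ (-(k : ℤ)) :=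
    Metric.ball_mem_nhds _ hpos
  filter_upwards [h1] with ab hab
  rw [Prod.dist_eq, max_lt_iff, dist_eq_norm, dist_eq_norm] at hab
  refine hk ab.1 ab.2 ?_ ?_
  · exact Ideal.mem_span_singleton.mp ((PadicInt.norm_le_pow_iff_mem_span_pow _ k).mp hab.1.le)
  · exact Ideal.mem_span_singleton.mp ((PadicInt.norm_le_pow_iff_mem_span_pow _ k).mp hab.2.le)

end Literature.Algebra.Polynomial

end
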